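import Literature.MathematicalPhysics.KineticTheory.CellChainLangevin
import Literature.MathematicalPhysics.KineticTheory.LangevinChainEnergyScale
import HarnessLib

/-!
# The cell chains at energy scale `K⁴`: force and momentum bounds, the linear energy bound (CEHR Lemma 5.10)

Topic `Literature/MathematicalPhysics/KineticTheory`, grouping namespace `…KineticTheory.HeatConduction`.
The section `ScaleBounds` of `LangevinChainEnergyScale.lean` (written for the homogeneous pinned chain
`pinnedChain ω₂ lam β γ`), RE-INSTANTIATED for the CELL CHAINS `cellChain ω₂ lam β γ c` of
`CellChain.lean` (`U_i(q) = ω₂q²/2 + [c i] lam q⁴/4`, `V_i(r) = r²/2 + [c i] β r⁴/4`, baths `γ` at the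
sites `0` and `N - 1`; `ω₂ > 0`, `lam, β, γ ≥ 0`, ANY cell indicator `c : ℕ → Bool`).
Cuneo–Eckmann–Hairer–Rey-Bellet, EJP **23** (2018) no. 55, §5, Lemma 5.10: at energy `H ≍ K⁴` the
momenta are `O(K²)` and the forces `O(K³)`. In integer-power, linear form (`K ≥ 1`):

* `cellChain_site_le_hamiltonian_scale`: `ω₂q_i²/2 + [c i] lam q_i⁴/4 ≤ H`;
* `cellChain_abs_deriv_U_le_scale`: `|U_i'(q_i)| ≤ 4H/K + (ω₂ + lam)K³`;
* `cellChain_abs_deriv_V_le_scale`: `|V_k'(q_{k+1} - q_k)| ≤ 4H/K + (1 + β)K³`;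
* `cellChain_abs_momentum_le_scale`: `|p_i| ≤ H/K² + K²/2`;
* `cellChain_sum_abs_partialQ_le_scale`: `∑_i |∂_{q_i}H| ≤ (4N(1+N²)/K) H + N(ω₂ + lam + N²(1+β))K³`;
* `cellChain_linearEnergyBound_scale`: `∑_i |∂_{q_i}H| + 2γ∑_i |p_i| ≤ (A/K) H + B K³` with THE SAME
  constants as the pinned chain, `A = pinnedChainScaleA γ N ≥ 1`, `B = pinnedChainScaleB ω₂ lam β γ N ≥ 0`
  (the switched amplitudes `[c i] lam ≤ lam`, `[c i] β ≤ β` only lower the bounds), and its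
  `(slope, offset)` form `cellChain_linearEnergyBound_scale_offset`:
  `… ≤ (A/K)(H + (B/A)K⁴)` — the input of the Grönwall lemma of `SiteChainPathwiseEnergy.lean`.

Everything is PROVED; no definition, no named fact. The elementary inequalities
`abs_le_sq_div_add_self`, `abs_pow_three_le_pow_four_div_add`, `abs_le_sq_div_sq_add`,
`abs_deriv_V_le_scale` and the constants are imported from `LangevinChainEnergyScale.lean`.

## References

* N. Cuneo, J.-P. Eckmann, M. Hairer, L. Rey-Bellet, *Non-equilibrium steady states for networks of
  oscillators*, Electron. J. Probab. **23** (2018) no. 55 (arXiv:1712.09413), §5, Lemma 5.10.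
* F. Bonetto, J. L. Lebowitz, L. Rey-Bellet, *Fourier's law: a challenge to theorists* (2000), §3
  eq. (8), §10 item 1.
-/

noncomputable section

open MeasureTheory Filter Topology Set Metric
open scoped NNReal

namespace Literature.MathematicalPhysics.KineticTheory.HeatConduction

open Literature.MathematicalPhysics.KineticTheory

section CellChainScale

variable {ω₂ lam β γ : ℝ} (hω : 0 < ω₂) (hl : 0 ≤ lam) (hβ : 0 ≤ β) (hγ : 0 ≤ γ) (c : ℕ → Bool)
  (N : ℕ)
include hω hl hβ hγ

/-- The pinning energy of one site is dominated by the total energy: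
`ω₂ q_i²/2 + [c i] lam q_i⁴/4 ≤ H(q, p)` for the cell chain (`ω₂ > 0`, `lam, β, γ ≥ 0`). [folklore] -/
theorem cellChain_site_le_hamiltonian_scale (x : PhaseSpace N) (i : Fin N) :
    ω₂ * x.1 i ^ 2 / 2 + (if c i.val then lam else 0) * x.1 i ^ 4 / 4 ≤
      (cellChain ω₂ lam β γ c).hamiltonian N x := by
  have hP := cellChain_uniformlyConfining hω hl hβ hγ c
  have h := (cellChain ω₂ lam β γ c).site_le_hamiltonian hP.U_nonneg hP.V_nonneg N x i
  have e : (cellChain ω₂ lam β γ c).U i.val (x.1 i) =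
      ω₂ * x.1 i ^ 2 / 2 + (if c i.val then lam else 0) * x.1 i ^ 4 / 4 := rfl
  nlinarith [sq_nonneg (x.2 i)]

/-- **The pinning force at scale `K ≥ 1`**: `|U_i'(q_i)| = |ω₂ q_i + [c i] lam q_i³| ≤ 4H/K + (ω₂ + lam) K³`
for the cell chain (no fractional powers: `ω₂|q| ≤ ω₂(q²/K + K)`, `lam|q|³ ≤ lam(q⁴/K + K³)` and
`ω₂q² + [c i] lam q⁴ ≤ 4H`). [cite: CuneoEckmannHairerReyBellet2018, Lemma 5.10] -/
theorem cellChain_abs_deriv_U_le_scale {K : ℝ} (hK : 1 ≤ K) (x : PhaseSpace N) (i : Fin N) :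
    |deriv ((cellChain ω₂ lam β γ c).U i.val) (x.1 i)| ≤
      4 * (cellChain ω₂ lam β γ c).hamiltonian N x / K + (ω₂ + lam) * K ^ 3 := by
  set h := (cellChain ω₂ lam β γ c).hamiltonian N x with hh
  set q := x.1 i with hq
  obtain ⟨hl0, hl1⟩ := ite_amplitude_mem_Icc hl (c i.val)
  set l := (if c i.val then lam else 0 : ℝ) with hldef
  have hK0 : 0 < K := by linarith
  have hU : ω₂ * q ^ 2 / 2 + l * q ^ 4 / 4 ≤ h :=
    cellChain_site_le_hamiltonian_scale hω hl hβ hγ c N x i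
  rw [cellChain_deriv_U_eq]
  have h1 : |ω₂ * q + l * q ^ 3| ≤ ω₂ * |q| + l * |q| ^ 3 := by
    calc |ω₂ * q + l * q ^ 3| ≤ |ω₂ * q| + |l * q ^ 3| := abs_add_le _ _
      _ = ω₂ * |q| + l * |q| ^ 3 := by
          rw [abs_mul, abs_mul, abs_of_pos hω, abs_of_nonneg hl0, abs_pow]
  have h2 := mul_le_mul_of_nonneg_left (abs_le_sq_div_add_self q hK0) hω.le
  have h3 := mul_le_mul_of_nonneg_left (abs_pow_three_le_pow_four_div_add q hK0) hl0
  have h4 : ω₂ * (q ^ 2 / K + K) + l * (q ^ 4 / K + K ^ 3) =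
      (ω₂ * q ^ 2 + l * q ^ 4) / K + (ω₂ * K + l * K ^ 3) := by
    field_simp
    ring
  have hq2 : 0 ≤ ω₂ * q ^ 2 := mul_nonneg hω.le (sq_nonneg q)
  have h5 : (ω₂ * q ^ 2 + l * q ^ 4) / K ≤ 4 * h / K :=
    div_le_div_of_nonneg_right (by linarith) hK0.le
  have h6 : ω₂ * K + l * K ^ 3 ≤ (ω₂ + lam) * K ^ 3 := by
    have hK3 : K ≤ K ^ 3 := le_self_pow₀ hK (by norm_num)
    have hK3' : 0 ≤ K ^ 3 := by positivity
    nlinarith [mul_le_mul_of_nonneg_right hl1 hK3', hω.le]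
  linarith [h1, h2, h3, h4, h5, h6]

/-- **The bond force at scale `K ≥ 1`**: `|V_k'(q_l - q_k)| = |r + [c k] β r³| ≤ 4H/K + (1 + β) K³`
for the bond `l = k + 1` of the cell chain (`r = q_l - q_k`, `r²/2 + [c k] β r⁴/4 ≤ H`).
[cite: CuneoEckmannHairerReyBellet2018, Lemma 5.10] -/
theorem cellChain_abs_deriv_V_le_scale {K : ℝ} (hK : 1 ≤ K) (x : PhaseSpace N) {k l : Fin N}
    (hlk : l.val = k.val + 1) :
    |deriv ((cellChain ω₂ lam β γ c).V k.val) (x.1 l - x.1 k)| ≤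
      4 * (cellChain ω₂ lam β γ c).hamiltonian N x / K + (1 + β) * K ^ 3 := by
  have hP := cellChain_uniformlyConfining hω hl hβ hγ c
  obtain ⟨hb0, hb1⟩ := ite_amplitude_mem_Icc hβ (c k.val)
  have hV := (cellChain ω₂ lam β γ c).bond_le_hamiltonian hP.U_nonneg hP.V_nonneg N x hlk
  have hE : (x.1 l - x.1 k) ^ 2 / 2 + (if c k.val then β else 0) * (x.1 l - x.1 k) ^ 4 / 4 ≤
      (cellChain ω₂ lam β γ c).hamiltonian N x := hV
  rw [cellChain_deriv_V_eq]
  have h := abs_deriv_V_le_scale hb0 hK hE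
  have hK3 : 0 ≤ K ^ 3 := by positivity
  nlinarith [mul_le_mul_of_nonneg_right hb1 hK3]

/-- **The momenta at scale `K > 0`**: `|p_i| ≤ H/K² + K²/2` for the cell chain.
[cite: CuneoEckmannHairerReyBellet2018, Lemma 5.10] -/
theorem cellChain_abs_momentum_le_scale {K : ℝ} (hK : 0 < K) (x : PhaseSpace N) (i : Fin N) :
    |x.2 i| ≤ (cellChain ω₂ lam β γ c).hamiltonian N x / K ^ 2 + K ^ 2 / 2 := by
  set h := (cellChain ω₂ lam β γ c).hamiltonian N x with hh
  have hP := cellChain_uniformlyConfining hω hl hβ hγ c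
  have hs := (cellChain ω₂ lam β γ c).site_le_hamiltonian hP.U_nonneg hP.V_nonneg N x i
  have hU0 := hP.U_nonneg i.val (x.1 i)
  have hp' : x.2 i ^ 2 / 2 ≤ h := by linarith
  have h1 := abs_le_sq_div_sq_add (x.2 i) hK
  have h2 : x.2 i ^ 2 / (2 * K ^ 2) ≤ h / K ^ 2 := by
    rw [div_le_div_iff₀ (by positivity) (by positivity)]
    nlinarith [sq_nonneg K]
  linarith

/-- **The force bound at scale `K ≥ 1`** for the cell chain:
`∑_i |∂_{q_i}H(x)| ≤ (4N(1+N²)/K) H(x) + N(ω₂ + lam + N²(1+β)) K³`.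
[cite: CuneoEckmannHairerReyBellet2018, Lemma 5.10] -/
theorem cellChain_sum_abs_partialQ_le_scale {K : ℝ} (hK : 1 ≤ K) (x : PhaseSpace N) :
    ∑ i, |partialQ i ((cellChain ω₂ lam β γ c).hamiltonian N) x| ≤
      4 * N * (1 + (N : ℝ) ^ 2) / K * (cellChain ω₂ lam β γ c).hamiltonian N x +
        N * (ω₂ + lam + (N : ℝ) ^ 2 * (1 + β)) * K ^ 3 := by
  set P := cellChain ω₂ lam β γ c with hPdef
  set H := P.hamiltonian N x with hH
  have hP := cellChain_uniformlyConfining hω hl hβ hγ c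
  have hK0 : 0 < K := by linarith
  have hH0 : 0 ≤ H := hP.hamiltonian_nonneg N x
  have hbond : 0 ≤ 4 * H / K + (1 + β) * K ^ 3 := by positivity
  have hterm : ∀ i : Fin N, |partialQ i (P.hamiltonian N) x| ≤
      (4 * H / K + (ω₂ + lam) * K ^ 3) + N ^ 2 * (4 * H / K + (1 + β) * K ^ 3) := by
    intro i
    rw [P.partialQ_hamiltonian_eq_dPotential hP.differentiable_U hP.differentiable_V, SiteChain.dPotential]
    refine (abs_add_le _ _).trans (add_le_add
      (cellChain_abs_deriv_U_le_scale hω hl hβ hγ c N hK x i) ?_)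
    refine (Finset.abs_sum_le_sum_abs _ _).trans ?_
    have hkl : ∀ k l : Fin N, |(if l.val = k.val + 1 then
        deriv (P.V k.val) (x.1 l - x.1 k) * ((if l = i then 1 else 0) - (if k = i then 1 else 0)) else 0)| ≤
        4 * H / K + (1 + β) * K ^ 3 := by
      intro k l
      have hs : |((if l = i then (1 : ℝ) else 0) - (if k = i then 1 else 0))| ≤ 1 := by
        split_ifs <;> norm_num
      by_cases hlk : l.val = k.val + 1
      · rw [if_pos hlk, abs_mul]
        have hV' : |deriv (P.V k.val) (x.1 l - x.1 k)| ≤ 4 * H / K + (1 + β) * K ^ 3 :=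
          cellChain_abs_deriv_V_le_scale hω hl hβ hγ c N hK x hlk
        calc |deriv (P.V k.val) (x.1 l - x.1 k)| *
              |((if l = i then (1 : ℝ) else 0) - (if k = i then 1 else 0))|
            ≤ (4 * H / K + (1 + β) * K ^ 3) * 1 := mul_le_mul hV' hs (abs_nonneg _) hbond
          _ = _ := mul_one _
      · rw [if_neg hlk, abs_zero]
        exact hbond
    calc ∑ k : Fin N, |∑ l : Fin N, (if l.val = k.val + 1 then
          deriv (P.V k.val) (x.1 l - x.1 k) * ((if l = i then 1 else 0) - (if k = i then 1 else 0)) else 0)|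
        ≤ ∑ k : Fin N, ∑ l : Fin N, (4 * H / K + (1 + β) * K ^ 3) :=
          Finset.sum_le_sum fun k _ => (Finset.abs_sum_le_sum_abs _ _).trans
            (Finset.sum_le_sum fun l _ => hkl k l)
      _ = N ^ 2 * (4 * H / K + (1 + β) * K ^ 3) := by simp; ring
  calc ∑ i, |partialQ i (P.hamiltonian N) x|
      ≤ ∑ _i : Fin N, ((4 * H / K + (ω₂ + lam) * K ^ 3) + N ^ 2 * (4 * H / K + (1 + β) * K ^ 3)) :=
        Finset.sum_le_sum fun i _ => hterm i
    _ = _ := by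
        simp only [Finset.sum_const, Finset.card_univ, Fintype.card_fin, nsmul_eq_mul]
        field_simp
        ring

/-- **The linear energy bound at scale `K ≥ 1`** for the cell chain:
`∑_i |∂_{q_i}H| + 2γ ∑_i |p_i| ≤ (A/K) H + B K³` with the constants of the pinned chain,
`A = pinnedChainScaleA γ N`, `B = pinnedChainScaleB ω₂ lam β γ N` (uniform in the cell indicator): at
energies `≍ K⁴` the forces and the friction are `O(K³)`, with slope `A/K → 0`.
[cite: CuneoEckmannHairerReyBellet2018, Lemma 5.10] -/
theorem cellChain_linearEnergyBound_scale {K : ℝ} (hK : 1 ≤ K) (x : PhaseSpace N) :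
    (∑ i, |partialQ i ((cellChain ω₂ lam β γ c).hamiltonian N) x|) + 2 * γ * ∑ i, |x.2 i| ≤
      pinnedChainScaleA γ N / K * (cellChain ω₂ lam β γ c).hamiltonian N x +
        pinnedChainScaleB ω₂ lam β γ N * K ^ 3 := by
  set H := (cellChain ω₂ lam β γ c).hamiltonian N x with hH
  have hP := cellChain_uniformlyConfining hω hl hβ hγ c
  have hK0 : 0 < K := by linarith
  have hH0 : 0 ≤ H := hP.hamiltonian_nonneg N x
  have h1 := cellChain_sum_abs_partialQ_le_scale hω hl hβ hγ c N hK x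
  have h2 : ∑ i, |x.2 i| ≤ N * (H / K ^ 2 + K ^ 2 / 2) := by
    calc ∑ i, |x.2 i| ≤ ∑ _i : Fin N, (H / K ^ 2 + K ^ 2 / 2) :=
          Finset.sum_le_sum fun i _ => cellChain_abs_momentum_le_scale hω hl hβ hγ c N hK0 x i
      _ = N * (H / K ^ 2 + K ^ 2 / 2) := by simp [mul_add]
  have h3 : H / K ^ 2 ≤ H / K := by
    rw [div_le_div_iff₀ (by positivity) hK0]
    have : K ≤ K ^ 2 := le_self_pow₀ hK (by norm_num)
    nlinarith
  have h4 : K ^ 2 / 2 ≤ K ^ 3 / 2 := by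
    have : K ^ 2 ≤ K ^ 3 := pow_le_pow_right₀ hK (by norm_num)
    linarith
  have h5 : 2 * γ * ∑ i, |x.2 i| ≤ 2 * γ * N / K * H + γ * N * K ^ 3 := by
    have := mul_le_mul_of_nonneg_left h2 (by positivity : 0 ≤ 2 * γ)
    have h6 : 2 * γ * (N * (H / K ^ 2 + K ^ 2 / 2)) ≤ 2 * γ * (N * (H / K + K ^ 3 / 2)) := by
      gcongr
    calc 2 * γ * ∑ i, |x.2 i| ≤ 2 * γ * (N * (H / K + K ^ 3 / 2)) := this.trans h6
      _ = 2 * γ * N / K * H + γ * N * K ^ 3 := by ring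
  have h7 : (0 : ℝ) ≤ 1 / K * H := by positivity
  unfold pinnedChainScaleA pinnedChainScaleB
  have e : (4 * N * (1 + (N : ℝ) ^ 2) + 2 * γ * N + 1) / K * H +
      (N * (ω₂ + lam + (N : ℝ) ^ 2 * (1 + β)) + γ * N) * K ^ 3 =
      (4 * N * (1 + (N : ℝ) ^ 2) / K * H + N * (ω₂ + lam + (N : ℝ) ^ 2 * (1 + β)) * K ^ 3) +
        (2 * γ * N / K * H + γ * N * K ^ 3) + 1 / K * H := by ring
  rw [e]
  linarith

/-- **The linear energy bound at scale `K ≥ 1` in slope–offset form**: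
`∑_i |∂_{q_i}H| + 2γ ∑_i |p_i| ≤ (A/K) (H + (B/A) K⁴)` (the shape consumed by Grönwall for the smooth
part of the driven flow, `SiteChain.hamiltonian_smoothPart_add_le_mul_exp`).
[cite: CuneoEckmannHairerReyBellet2018, Lemma 5.10] -/
theorem cellChain_linearEnergyBound_scale_offset {K : ℝ} (hK : 1 ≤ K) (x : PhaseSpace N) :
    (∑ i, |partialQ i ((cellChain ω₂ lam β γ c).hamiltonian N) x|) +
        2 * (cellChain ω₂ lam β γ c).γ * ∑ i, |x.2 i| ≤
      pinnedChainScaleA γ N / K * ((cellChain ω₂ lam β γ c).hamiltonian N x +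
        pinnedChainScaleB ω₂ lam β γ N / pinnedChainScaleA γ N * K ^ 4) := by
  have h := cellChain_linearEnergyBound_scale hω hl hβ hγ c N hK x
  have hA : 0 < pinnedChainScaleA γ N := lt_of_lt_of_le one_pos (one_le_pinnedChainScaleA hγ N)
  have hK0 : 0 < K := by linarith
  have e : pinnedChainScaleA γ N / K * ((cellChain ω₂ lam β γ c).hamiltonian N x +
      pinnedChainScaleB ω₂ lam β γ N / pinnedChainScaleA γ N * K ^ 4) =
      pinnedChainScaleA γ N / K * (cellChain ω₂ lam β γ c).hamiltonian N x +
        pinnedChainScaleB ω₂ lam β γ N * K ^ 3 := by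
    field_simp
  rw [cellChain_γ, e]
  exact h

end CellChainScale

end Literature.MathematicalPhysics.KineticTheory.HeatConduction
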